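import Summits.NavierStokesRegularity.NavierStokesRegularity.Theorems.RungReynoldsOne.Negative.BudgetCeiling
import HarnessLib

/-!
# Crux `Target` = `TypeICertificateLadder.NoTypeIBlowup` (stmt-NavierStokesRegularity-1217), line
# `depletion-ladder`: REACH OF THE DEPLETED `L^q`-VORTICITY BUDGETS — how much depletion, of which
# trilinear piece, at which `q`, clears the `√6 − √2` ceiling

`--supports stmt-NavierStokesRegularity-1217` (line `depletion-ladder`; bookkeeping companion of
`RungReynoldsOne/Negative/BudgetCeiling.lean` and of the landed stub S2
`Theorems.rung_of_stretchingDepletion`, p471856; it re-targets the open stub S1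
`stub_depletionBelowHalf`).

The `L^q`-vorticity budget behind rung one and behind `BudgetCeiling` reads, after the stretching
term `∫|ω|^{q−2}⟪ω, Du ω⟫` is integrated by parts onto `u` (`div ω = 0`),

  `∫|ω|^{q−2}⟪ω, Du ω⟫ = −∫⟪u, |ω|^{q−2} (ω·∇)ω⟫ − (q−2)∫⟪u, |ω|^{q−3}(ω·∇|ω|) ω⟫ =: −A − (q−2)·B`,

and each piece is closed by Cauchy–Schwarz and Young against its own viscous piece
(`νq∫|ω|^{q−2}|∇ω|²` and `νq(q−2)∫|ω|^{q−2}|∇|ω||²`): `|A| ≤ κ_A·‖u‖_∞·(∫|ω|^q)^{1/2}(∫|ω|^{q−2}|∇ω|²_F)^{1/2}`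
and `|B| ≤ κ_B·‖u‖_∞·(∫|ω|^q)^{1/2}(∫|ω|^{q−2}|∇|ω||²)^{1/2}` with the Cauchy–Schwarz values
`κ_A = κ_B = 1` give `d/dt‖ω‖_q^q ≤ q(κ_A² + (q−2)κ_B²)‖u‖²_∞‖ω‖_q^q/(4ν)` — at `κ_A = κ_B = 1`
exactly the coefficient `q(q−1)/4` of `BudgetCeiling` (rung one is its `q = 5/2` member,
`(5/2)(1 + 1/2)/4 = 15/16`, `RungReynoldsOne.weightedSlice_budget`), and at `q = 2` (where `B`
is absent) exactly the depletion family of the line: `κ_A` = `StretchingDepletion κ` of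
`Cruxes/Target/Lines/depletion_ladder.lean`, the pairing `∫⟪u, (ω·∇)ω⟫ = −∫⟪ω, Du ω⟫` being the one
bounded in `Theorems.DepletionLadder.stretchingDepletion_one`. Against the Leray–Giga lower exponent
`q − 3/2` the DEPLETED budget closes rung `X_C` iff

  `(q * (κ_A ^ 2 + (q - 2) * κ_B ^ 2) * C ^ 2 / 4 < q - 3 / 2) :  q (κ_A² + (q−2) κ_B²) C² / 4 < q − 3/2`.

This file settles, by real arithmetic only and independently of the analytic validity of the
budgets for `q ≠ 2, 5/2` (exactly as `BudgetCeiling` does for `κ = 1`), WHERE the line's lever has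
to be pulled:
* `q = 2` (the line as registered): the budget closes iff `κ_A C < 1` (`depletedBudgetCloses_two_iff`,
  the hypothesis shape of S2 `rung_of_stretchingDepletion`), so a rung above the ceiling needs
  `κ_A < (√6+√2)/4 < 0.966` (`exists_gt_ceiling_two_iff`): a 3.4 % depletion.
* `q = 5/2` (the tree's OWN analytic chain of rung one, `κ_B = 1` untouched): the budget clears the
  ceiling iff `κ_A² < (3 + 4√3)/10` (`exists_gt_ceiling_five_halves_iff`), in particular for every
  `κ_A ≤ 199/200` (`exists_gt_ceiling_five_halves_of_le`): a 0.5 % depletion of the `|ω|^{1/2}`-weighted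
  pairing `∫⟪u, |ω|^{1/2}(ω·∇)ω⟫` ALONE is a rung above `√6 − √2`.
* `q* = (3+√3)/2` (where the ceiling is attained): ANY depletion of EITHER piece clears the ceiling
  (`exists_gt_ceiling_qstar`).
Numerically the `q = 2` constant is `κ̂ ≈ 0.14` (strategist kit j021500, 32 restarts); the companion
kit job of this file measures the `q = 5/2` constants. WHAT THIS IS NOT: not a depletion constant
(S1 open), not a rung; the `q = 5/2` implication "depletion ⇒ rung" is NOT landed (only `q = 2`,
p471856) — this is the bookkeeping that says it is worth landing. [folklore]

References: H. Beirão da Veiga, Chinese Ann. Math. B 16 (1995) §2 (`L^q` vorticity method);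
Lemarié-Rieusset 2016, Thm. 11.2, §11.6; Robinson–Sadowski–Silva, J. Math. Phys. 53 (2012) 115618
(Leray–Giga `L^r` rates).
-/

noncomputable section

namespace Summit.NavierStokesRegularity.NavierStokesRegularity.Theorems.DepletionLadder

-- the problem directory repeats the summit name (`NavierStokesRegularity/NavierStokesRegularity`)
set_option linter.dupNamespace false

open Summit.NavierStokesRegularity.NavierStokesRegularity.Theorems.RungReynoldsOneNegative

/-! Throughout, "the depleted `L^q` budget with constants `κ_A, κ_B` closes rung `C`" is the real
inequality `q * (κA ^ 2 + (q - 2) * κB ^ 2) * C ^ 2 / 4 < q - 3 / 2` (upper Grönwall exponent of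
`‖ω‖_q^q` under the rate `‖u(t)‖²_∞ ≤ C²ν/(T−t)` versus the Leray–Giga lower exponent), written out
in every statement (no new definition is introduced). -/

/-- At the Cauchy–Schwarz values `κ_A = κ_B = 1` the depleted budget is `BudgetCeiling`'s budget
`q(q−1)C²/4 < q − 3/2` verbatim. -/
theorem depletedBudgetCloses_one_one_iff (q C : ℝ) :
    (q * (1 ^ 2 + (q - 2) * 1 ^ 2) * C ^ 2 / 4 < q - 3 / 2) ↔ q * (q - 1) * C ^ 2 / 4 < q - 3 / 2 := by
  constructor <;> intro h <;> nlinarith [h]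

/-! (Hence, by `RungReynoldsOneNegative.lt_ceiling_of_budgetCloses` of `BudgetCeiling.lean`, without
depletion no rung `C ≥ √6 − √2` closes for any `q > 1`; the ceiling facts
`sqrt_six_sub_sqrt_two_sq : (√6 − √2)² = 8 − 4√3` and `sqrt_six_sub_sqrt_two_bounds` are imported
from there.) -/

/-- The budget is monotone in the depletion constants (for `q ≥ 2`, where the `B`-coefficient
`q − 2` is non-negative): smaller constants close every rung the larger ones close. -/
theorem depletedBudget_mono {q κA κB κA' κB' C : ℝ} (hq : 2 ≤ q)
    (h : (q * (κA ^ 2 + (q - 2) * κB ^ 2) * C ^ 2 / 4 < q - 3 / 2)) (hA : 0 ≤ κA') (hA' : κA' ≤ κA) (hB : 0 ≤ κB')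
    (hB' : κB' ≤ κB) : (q * (κA' ^ 2 + (q - 2) * κB' ^ 2) * C ^ 2 / 4 < q - 3 / 2) := by
  have h1 : κA' ^ 2 ≤ κA ^ 2 := pow_le_pow_left₀ hA hA' 2
  have h2 : κB' ^ 2 ≤ κB ^ 2 := pow_le_pow_left₀ hB hB' 2
  have h3 : (q - 2) * κB' ^ 2 ≤ (q - 2) * κB ^ 2 := mul_le_mul_of_nonneg_left h2 (by linarith)
  have h4 : κA' ^ 2 + (q - 2) * κB' ^ 2 ≤ κA ^ 2 + (q - 2) * κB ^ 2 := by linarith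
  have hC : 0 ≤ C ^ 2 := sq_nonneg C
  have h5 : q * (κA' ^ 2 + (q - 2) * κB' ^ 2) * C ^ 2 / 4 ≤
      q * (κA ^ 2 + (q - 2) * κB ^ 2) * C ^ 2 / 4 := by
    have : q * (κA' ^ 2 + (q - 2) * κB' ^ 2) ≤ q * (κA ^ 2 + (q - 2) * κB ^ 2) :=
      mul_le_mul_of_nonneg_left h4 (by linarith)
    have := mul_le_mul_of_nonneg_right this hC
    linarith
  exact h5.trans_lt h

/-- The budget is monotone in the rung: a depleted budget closing `C` closes every `C' ≤ C`
(`0 ≤ C'`), provided its coefficient is non-negative (`q ≥ 2`). -/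
theorem depletedBudget_of_le {q κA κB C C' : ℝ} (hq : 2 ≤ q)
    (h : (q * (κA ^ 2 + (q - 2) * κB ^ 2) * C ^ 2 / 4 < q - 3 / 2)) (hC' : 0 ≤ C') (hle : C' ≤ C) :
    (q * (κA ^ 2 + (q - 2) * κB ^ 2) * C' ^ 2 / 4 < q - 3 / 2) := by
  have h1 : C' ^ 2 ≤ C ^ 2 := pow_le_pow_left₀ hC' hle 2
  have hk : 0 ≤ q * (κA ^ 2 + (q - 2) * κB ^ 2) := by
    have : 0 ≤ κA ^ 2 + (q - 2) * κB ^ 2 := by nlinarith [sq_nonneg κA, sq_nonneg κB]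
    exact mul_nonneg (by linarith) this
  have := mul_le_mul_of_nonneg_left h1 hk
  linarith

/-! ## `q = 2`: the line as registered (`StretchingDepletion κ`, stub S2) -/

/-- The `q = 2` member of the depleted family: the magnitude piece `B` carries the factor `q − 2 = 0`,
so only `κ_A` enters: `2(κ² + 0·κ_B²)C²/4 = 2κ²C²/4`. -/
theorem depletedBudget_two_eq (κ κB C : ℝ) :
    2 * (κ ^ 2 + (2 - 2) * κB ^ 2) * C ^ 2 / 4 = 2 * κ ^ 2 * C ^ 2 / 4 := by ring

/-- **`q = 2`.** The depleted enstrophy budget closes rung `C` iff `κ_A·C < 1` — the hypothesis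
shape `κ * C < 1` of the landed stub S2 `rung_of_stretchingDepletion` (there an honest theorem about
Navier–Stokes; here its exponent bookkeeping). The `B`-piece is absent at `q = 2`. -/
theorem depletedBudgetCloses_two_iff {κ C : ℝ} (hκ : 0 ≤ κ) (hC : 0 ≤ C) :
    (2 * κ ^ 2 * C ^ 2 / 4 < 2 - 3 / 2) ↔ κ * C < 1 := by
  have hκC : 0 ≤ κ * C := mul_nonneg hκ hC
  constructor
  · intro h
    have h' : (κ * C) ^ 2 < 1 := by nlinarith [h]
    nlinarith [h', hκC]
  · intro h
    have h' : (κ * C) ^ 2 < 1 := by nlinarith [h, hκC]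
    nlinarith [h']

/-- `(√6 + √2)(√6 − √2) = 4`: the reciprocal of the ceiling is `(√6 + √2)/4`. -/
theorem sqrt_six_add_sqrt_two_mul : (Real.sqrt 6 + Real.sqrt 2) * (Real.sqrt 6 - Real.sqrt 2) = 4 := by
  have h6 : Real.sqrt 6 ^ 2 = 6 := Real.sq_sqrt (by norm_num)
  have h2 : Real.sqrt 2 ^ 2 = 2 := Real.sq_sqrt (by norm_num)
  nlinarith [h6, h2]

/-- Numerical bracket `0.9659 < (√6 + √2)/4 < 0.966`. -/
theorem sqrt_six_add_sqrt_two_div_four_bounds :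
    (0.9659 : ℝ) < (Real.sqrt 6 + Real.sqrt 2) / 4 ∧ (Real.sqrt 6 + Real.sqrt 2) / 4 < 0.966 := by
  have h6l : (2.44948 : ℝ) < Real.sqrt 6 := (Real.lt_sqrt (by norm_num)).2 (by norm_num)
  have h6u : Real.sqrt 6 < (2.4495 : ℝ) := (Real.sqrt_lt' (by norm_num)).2 (by norm_num)
  have h2l : (1.41421 : ℝ) < Real.sqrt 2 := (Real.lt_sqrt (by norm_num)).2 (by norm_num)
  have h2u : Real.sqrt 2 < (1.41422 : ℝ) := (Real.sqrt_lt' (by norm_num)).2 (by norm_num)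
  constructor <;> linarith

/-- **What the registered line needs.** At `q = 2` some rung STRICTLY ABOVE the ceiling `√6 − √2`
closes iff `κ_A < (√6 + √2)/4` (`< 0.966`): the depletion constant has to drop by at least 3.4 %
below its Cauchy–Schwarz value before stub S2 yields a new rung (the card's "any certified
`κ < (√6+√2)/4 ≈ 0.966` is already a rung above the kernel-checked ceiling"). -/
theorem exists_gt_ceiling_two_iff {κ : ℝ} (hκ : 0 < κ) :
    (∃ C : ℝ, Real.sqrt 6 - Real.sqrt 2 < C ∧ (2 * κ ^ 2 * C ^ 2 / 4 < 2 - 3 / 2)) ↔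
      κ < (Real.sqrt 6 + Real.sqrt 2) / 4 := by
  have hc0 : 0 < Real.sqrt 6 - Real.sqrt 2 := by linarith [sqrt_six_sub_sqrt_two_bounds.1]
  have hprod := sqrt_six_add_sqrt_two_mul
  constructor
  · rintro ⟨C, hC, hcl⟩
    have hC0 : 0 ≤ C := (hc0.trans hC).le
    rw [depletedBudgetCloses_two_iff hκ.le hC0] at hcl
    -- κ (√6 − √2) < κ C < 1, and 1/(√6 − √2) = (√6 + √2)/4
    have h1 : κ * (Real.sqrt 6 - Real.sqrt 2) < 1 := by nlinarith [hcl, hC, hκ]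
    nlinarith [h1, hprod, hc0]
  · intro h
    -- take C with κ C < 1 and C > √6 − √2: the midpoint between √6 − √2 and 1/κ
    have hinv : Real.sqrt 6 - Real.sqrt 2 < 1 / κ := by
      rw [lt_div_iff₀ hκ]
      nlinarith [h, hprod, hc0]
    refine ⟨(Real.sqrt 6 - Real.sqrt 2 + 1 / κ) / 2, by linarith, ?_⟩
    have hC0 : 0 ≤ (Real.sqrt 6 - Real.sqrt 2 + 1 / κ) / 2 := by
      have : 0 < 1 / κ := by positivity
      linarith
    rw [depletedBudgetCloses_two_iff hκ.le hC0]
    have hlt : (Real.sqrt 6 - Real.sqrt 2 + 1 / κ) / 2 < 1 / κ := by linarith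
    calc κ * ((Real.sqrt 6 - Real.sqrt 2 + 1 / κ) / 2) < κ * (1 / κ) :=
          mul_lt_mul_of_pos_left hlt hκ
      _ = 1 := by field_simp

/-! ## `q = 5/2`: the tree's own analytic chain of rung one -/

/-- **`q = 5/2`, `κ_B = 1`.** The depleted `L^{5/2}` budget — the weight of rung one's
`weightedSlice_budget`, whose Young factor `3/8 = (1 + 1/2)/4` is the case `κ_A = κ_B = 1` — closes
rung `C` iff `(κ_A² + 1/2)·C² < 8/5`. -/
theorem depletedBudgetCloses_five_halves_iff (κA C : ℝ) :
    ((5 / 2) * (κA ^ 2 + (5 / 2 - 2) * 1 ^ 2) * C ^ 2 / 4 < 5 / 2 - 3 / 2) ↔ (κA ^ 2 + 1 / 2) * C ^ 2 < 8 / 5 := by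
  constructor <;> intro h <;> nlinarith [h]

/-- `8/(5(8 − 4√3)) − 1/2 = (3 + 4√3)/10`: the threshold at `q = 5/2`. -/
theorem five_halves_threshold_mul_ceiling_sq :
    ((3 + 4 * Real.sqrt 3) / 10 + 1 / 2) * (8 - 4 * Real.sqrt 3) = 8 / 5 := by
  have hs3 : Real.sqrt 3 ^ 2 = 3 := Real.sq_sqrt (by norm_num)
  nlinarith [hs3]

/-- Numerical bracket `0.9928 < (3 + 4√3)/10 < 0.9929` (so `κ_A ≤ 0.996` suffices and
`κ_A = 0.9965` does not). -/
theorem five_halves_threshold_bounds :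
    (0.9928 : ℝ) < (3 + 4 * Real.sqrt 3) / 10 ∧ (3 + 4 * Real.sqrt 3) / 10 < 0.9929 := by
  have h3l : (1.73205 : ℝ) < Real.sqrt 3 := (Real.lt_sqrt (by norm_num)).2 (by norm_num)
  have h3u : Real.sqrt 3 < (1.732051 : ℝ) := (Real.sqrt_lt' (by norm_num)).2 (by norm_num)
  constructor <;> linarith

/-- **What the `q = 5/2` chain needs.** With the magnitude piece untouched (`κ_B = 1`), some rung
strictly above the ceiling `√6 − √2` closes in the depleted `L^{5/2}` budget iff
`κ_A² < (3 + 4√3)/10` (`κ_A ≥ 0`), i.e. iff `κ_A < 0.99641…`: a depletion of the single pairing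
`∫⟪u, |ω|^{1/2}(ω·∇)ω⟫` by 0.36 % clears the ceiling. -/
theorem exists_gt_ceiling_five_halves_iff (κA : ℝ) :
    (∃ C : ℝ, Real.sqrt 6 - Real.sqrt 2 < C ∧ ((5 / 2) * (κA ^ 2 + (5 / 2 - 2) * 1 ^ 2) * C ^ 2 / 4 < 5 / 2 - 3 / 2)) ↔
      κA ^ 2 < (3 + 4 * Real.sqrt 3) / 10 := by
  have hc0 : 0 < Real.sqrt 6 - Real.sqrt 2 := by linarith [sqrt_six_sub_sqrt_two_bounds.1]
  have hcsq := sqrt_six_sub_sqrt_two_sq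
  have hthr := five_halves_threshold_mul_ceiling_sq
  have h843 : 0 < 8 - 4 * Real.sqrt 3 := by rw [← hcsq]; positivity
  constructor
  · rintro ⟨C, hC, hcl⟩
    rw [depletedBudgetCloses_five_halves_iff] at hcl
    have hC2 : (Real.sqrt 6 - Real.sqrt 2) ^ 2 < C ^ 2 := pow_lt_pow_left₀ hC hc0.le two_ne_zero
    rw [hcsq] at hC2
    have hk : 0 < κA ^ 2 + 1 / 2 := by positivity
    -- (κ²+1/2)(8−4√3) < (κ²+1/2) C² < 8/5 = ((3+4√3)/10 + 1/2)(8 − 4√3)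
    have h1 : (κA ^ 2 + 1 / 2) * (8 - 4 * Real.sqrt 3) < 8 / 5 :=
      (mul_lt_mul_of_pos_left hC2 hk).trans hcl
    rw [← hthr] at h1
    have h2 := lt_of_mul_lt_mul_right h1 h843.le
    linarith
  · intro h
    -- C₁² := (8/5)/(κ²+1/2) exceeds (√6 − √2)² = 8 − 4√3; take the midpoint of √6 − √2 and C₁.
    have hk : 0 < κA ^ 2 + 1 / 2 := by positivity
    set C₁ : ℝ := Real.sqrt (8 / 5 / (κA ^ 2 + 1 / 2)) with hC₁
    have hC₁sq : C₁ ^ 2 = 8 / 5 / (κA ^ 2 + 1 / 2) := Real.sq_sqrt (by positivity)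
    have hlt : 8 - 4 * Real.sqrt 3 < 8 / 5 / (κA ^ 2 + 1 / 2) := by
      rw [lt_div_iff₀ hk, ← hthr]
      have : κA ^ 2 + 1 / 2 < (3 + 4 * Real.sqrt 3) / 10 + 1 / 2 := by linarith
      nlinarith [this, h843]
    have hC₁gt : Real.sqrt 6 - Real.sqrt 2 < C₁ := by
      rw [hC₁, ← Real.sqrt_sq hc0.le, hcsq]
      exact Real.sqrt_lt_sqrt h843.le hlt
    refine ⟨(Real.sqrt 6 - Real.sqrt 2 + C₁) / 2, by linarith, ?_⟩
    rw [depletedBudgetCloses_five_halves_iff]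
    have hmid0 : 0 ≤ (Real.sqrt 6 - Real.sqrt 2 + C₁) / 2 := by linarith
    have hmid : (Real.sqrt 6 - Real.sqrt 2 + C₁) / 2 < C₁ := by linarith
    have hsq : ((Real.sqrt 6 - Real.sqrt 2 + C₁) / 2) ^ 2 < C₁ ^ 2 :=
      pow_lt_pow_left₀ hmid hmid0 two_ne_zero
    calc (κA ^ 2 + 1 / 2) * ((Real.sqrt 6 - Real.sqrt 2 + C₁) / 2) ^ 2
        < (κA ^ 2 + 1 / 2) * C₁ ^ 2 := mul_lt_mul_of_pos_left hsq hk
      _ = 8 / 5 := by rw [hC₁sq]; field_simp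

/-- **Corollary.** Every depletion constant `κ_A ≤ 199/200` of the `|ω|^{1/2}`-weighted pairing
gives, in the `q = 5/2` bookkeeping, a rung strictly above `√6 − √2` — whereas at `q = 2` the same
constant gives nothing new (`199/200 > (√6+√2)/4`, `exists_gt_ceiling_two_iff`). -/
theorem exists_gt_ceiling_five_halves_of_le {κA : ℝ} (hκ : 0 ≤ κA) (hle : κA ≤ 199 / 200) :
    ∃ C : ℝ, Real.sqrt 6 - Real.sqrt 2 < C ∧ ((5 / 2) * (κA ^ 2 + (5 / 2 - 2) * 1 ^ 2) * C ^ 2 / 4 < 5 / 2 - 3 / 2) := by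
  rw [exists_gt_ceiling_five_halves_iff κA]
  have h1 : κA ^ 2 ≤ (199 / 200) ^ 2 := pow_le_pow_left₀ hκ hle 2
  have h2 : ((199 : ℝ) / 200) ^ 2 < 0.9928 := by norm_num
  linarith [five_halves_threshold_bounds.1]

/-- The same constant at `q = 2` closes no rung above the ceiling. -/
theorem not_exists_gt_ceiling_two_of_ge {κ : ℝ} (hge : 199 / 200 ≤ κ) :
    ¬ ∃ C : ℝ, Real.sqrt 6 - Real.sqrt 2 < C ∧ (2 * κ ^ 2 * C ^ 2 / 4 < 2 - 3 / 2) := by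
  have hκ : 0 < κ := by linarith
  rw [exists_gt_ceiling_two_iff hκ]
  linarith [sqrt_six_add_sqrt_two_div_four_bounds.2]

/-! ## `q* = (3 + √3)/2`: at the ceiling any depletion of either piece is a new rung -/

/-- The ceiling identity at `q*`: with `κ_A = κ_B = 1` the `q*`-budget is saturated EXACTLY at
`C² = 8 − 4√3` (`(3 − √3)/2 · (1 + (√3 − 1)/2) = √3/2`). -/
theorem qstar_coeff_mul_ceiling_sq (κA κB : ℝ) :
    (3 + Real.sqrt 3) / 2 * (κA ^ 2 + ((3 + Real.sqrt 3) / 2 - 2) * κB ^ 2) * (8 - 4 * Real.sqrt 3) / 4 =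
      (3 - Real.sqrt 3) / 2 * (κA ^ 2 + (Real.sqrt 3 - 1) / 2 * κB ^ 2) := by
  have hs3 : Real.sqrt 3 ^ 2 = 3 := Real.sq_sqrt (by norm_num)
  linear_combination (-(1 / 2 : ℝ) * (κA ^ 2 + (Real.sqrt 3 - 1) / 2 * κB ^ 2)) * hs3

/-- **At `q*` every depletion is a rung above the ceiling.** If `0 ≤ κ_A, κ_B ≤ 1` and one of them
is `< 1`, the depleted `q*`-budget closes some rung `C > √6 − √2` (at `κ_A = κ_B = 1` it closes none,
`BudgetCeiling.lean`). -/
theorem exists_gt_ceiling_qstar {κA κB : ℝ} (hA : 0 ≤ κA) (hA1 : κA ≤ 1) (hB : 0 ≤ κB)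
    (hB1 : κB ≤ 1) (hlt : κA < 1 ∨ κB < 1) :
    ∃ C : ℝ, Real.sqrt 6 - Real.sqrt 2 < C ∧
      (3 + Real.sqrt 3) / 2 * (κA ^ 2 + ((3 + Real.sqrt 3) / 2 - 2) * κB ^ 2) * C ^ 2 / 4 <
        (3 + Real.sqrt 3) / 2 - 3 / 2 := by
  have hc0 : 0 < Real.sqrt 6 - Real.sqrt 2 := by linarith [sqrt_six_sub_sqrt_two_bounds.1]
  have hcsq := sqrt_six_sub_sqrt_two_sq
  have hs3 : Real.sqrt 3 ^ 2 = 3 := Real.sq_sqrt (by norm_num)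
  have h3l : (1.7 : ℝ) < Real.sqrt 3 := (Real.lt_sqrt (by norm_num)).2 (by norm_num)
  have h3u : Real.sqrt 3 < (1.8 : ℝ) := (Real.sqrt_lt' (by norm_num)).2 (by norm_num)
  have h843 : 0 < 8 - 4 * Real.sqrt 3 := by rw [← hcsq]; positivity
  -- the coefficient k := q*(κ_A² + (q*−2)κ_B²)/4 is positive and k·(8−4√3) < q* − 3/2 = √3/2
  set k : ℝ := (3 + Real.sqrt 3) / 2 * (κA ^ 2 + ((3 + Real.sqrt 3) / 2 - 2) * κB ^ 2) / 4 with hk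
  have hsum1 : κA ^ 2 + (Real.sqrt 3 - 1) / 2 * κB ^ 2 < 1 + (Real.sqrt 3 - 1) / 2 := by
    have hA2 : κA ^ 2 ≤ 1 := by nlinarith
    have hB2 : κB ^ 2 ≤ 1 := by nlinarith
    have hpos : 0 < (Real.sqrt 3 - 1) / 2 := by linarith
    rcases hlt with h | h
    · have : κA ^ 2 < 1 := by nlinarith
      nlinarith [mul_le_mul_of_nonneg_left hB2 hpos.le]
    · have hB2' : κB ^ 2 < 1 := by nlinarith
      nlinarith [mul_lt_mul_of_pos_left hB2' hpos]
  have hkey : k * (8 - 4 * Real.sqrt 3) < (3 + Real.sqrt 3) / 2 - 3 / 2 := by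
    have hid := qstar_coeff_mul_ceiling_sq κA κB
    have hk' : k * (8 - 4 * Real.sqrt 3) =
        (3 - Real.sqrt 3) / 2 * (κA ^ 2 + (Real.sqrt 3 - 1) / 2 * κB ^ 2) := by
      rw [hk, ← hid]; ring
    rw [hk']
    have h33 : 0 < (3 - Real.sqrt 3) / 2 := by linarith
    have := mul_lt_mul_of_pos_left hsum1 h33
    have hval : (3 - Real.sqrt 3) / 2 * (1 + (Real.sqrt 3 - 1) / 2) = (3 + Real.sqrt 3) / 2 - 3 / 2 := by
      nlinarith [hs3]
    linarith
  -- case k ≤ 0 cannot happen (κ's ≥ 0, q* > 2) but we only need k ≥ 0 for monotonicity in C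
  have hk0 : 0 ≤ k := by
    rw [hk]
    have : 0 ≤ κA ^ 2 + ((3 + Real.sqrt 3) / 2 - 2) * κB ^ 2 := by
      have : 0 ≤ (3 + Real.sqrt 3) / 2 - 2 := by linarith
      positivity
    positivity
  by_cases hkz : k = 0
  · refine ⟨Real.sqrt 6 - Real.sqrt 2 + 1, by linarith, ?_⟩
    have : (3 + Real.sqrt 3) / 2 * (κA ^ 2 + ((3 + Real.sqrt 3) / 2 - 2) * κB ^ 2) *
        (Real.sqrt 6 - Real.sqrt 2 + 1) ^ 2 / 4 = k * (Real.sqrt 6 - Real.sqrt 2 + 1) ^ 2 := by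
      rw [hk]; ring
    rw [this, hkz, zero_mul]
    linarith
  · have hkpos : 0 < k := lt_of_le_of_ne hk0 (Ne.symm hkz)
    -- C₁² := (q* − 3/2)/k > 8 − 4√3; take the midpoint
    set C₁ : ℝ := Real.sqrt (((3 + Real.sqrt 3) / 2 - 3 / 2) / k) with hC₁
    have hnum : 0 < (3 + Real.sqrt 3) / 2 - 3 / 2 := by linarith
    have hC₁sq : C₁ ^ 2 = ((3 + Real.sqrt 3) / 2 - 3 / 2) / k := Real.sq_sqrt (by positivity)
    have hlt2 : 8 - 4 * Real.sqrt 3 < ((3 + Real.sqrt 3) / 2 - 3 / 2) / k := by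
      rw [lt_div_iff₀ hkpos]; linarith
    have hC₁gt : Real.sqrt 6 - Real.sqrt 2 < C₁ := by
      rw [hC₁, ← Real.sqrt_sq hc0.le, hcsq]
      exact Real.sqrt_lt_sqrt h843.le hlt2
    refine ⟨(Real.sqrt 6 - Real.sqrt 2 + C₁) / 2, by linarith, ?_⟩
    have hmid0 : 0 ≤ (Real.sqrt 6 - Real.sqrt 2 + C₁) / 2 := by linarith
    have hmid : (Real.sqrt 6 - Real.sqrt 2 + C₁) / 2 < C₁ := by linarith
    have hsq : ((Real.sqrt 6 - Real.sqrt 2 + C₁) / 2) ^ 2 < C₁ ^ 2 :=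
      pow_lt_pow_left₀ hmid hmid0 two_ne_zero
    have heq : (3 + Real.sqrt 3) / 2 * (κA ^ 2 + ((3 + Real.sqrt 3) / 2 - 2) * κB ^ 2) *
        ((Real.sqrt 6 - Real.sqrt 2 + C₁) / 2) ^ 2 / 4 =
        k * ((Real.sqrt 6 - Real.sqrt 2 + C₁) / 2) ^ 2 := by rw [hk]; ring
    rw [heq]
    calc k * ((Real.sqrt 6 - Real.sqrt 2 + C₁) / 2) ^ 2 < k * C₁ ^ 2 :=
          mul_lt_mul_of_pos_left hsq hkpos
      _ = (3 + Real.sqrt 3) / 2 - 3 / 2 := by rw [hC₁sq]; field_simp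

end Summit.NavierStokesRegularity.NavierStokesRegularity.Theorems.DepletionLadder

end
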